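import Summits.HodgeConjecture.HodgeConjecture.Cruxes.BlochSeedDiscOne.RowAlpha1RuleDSharp
import Summits.HodgeConjecture.HodgeConjecture.Cruxes.BlochSeedDiscOne.FineDoorRing2

/-!
# RowAlpha1FineDoor — ROW α1♯ (`RuleDSharp`) IMPLIES THE FINE DOOR (`RuleDPFine` and its N-side twin), kernel
(s4-search-1 g40, THE ONE Leg-B design-search lane; the lane's kernel debt of HANDOFF-s4-search-1-g39 §«Kernel debt» ∕ bus l.13490,
pen proof ALPHA1SHARP-search-1-g39.md f5bcbb713ce93061 §1 «(α) ⇒ (γ)»; director-hodge R19.858 (c), R19.861 (a))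

Token: line stmt-HodgeConjecture-18881 Cruxes/BlochSeedDiscOne/Lines/birth.lean 814a6a70c14e831a stub_rung_pad4_seedAt.

LETTER-MODEL BOOKKEEPING ONLY (`DepthBoundA4.Design`).  Nothing here is a sheaf, a display or a SEED, and nothing here is proved toward
HC ∕ HC_CM ∕ HC_AV ∕ №4 ∕ 26512 ∕ 18881 ∕ 30548 ∕ H2.  Evidence-grade file (not a rung); sorry-free; imports the TREE copies of
`RowAlpha1RuleDSharp` (idea-crit-hsem-3 g23, 653f54d5bc583e1a, vendored by c5c8-1 g54) and `FineDoorRing2` (sheaf8-1) only;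
no `axiom` ∕ `instance` ∕ `unsafe` ∕ `native_decide`; no new `Prop`-valued door is DEFINED (the N-side twin is stated unfolded).

## The three support-level readings of door (H2) and what this file puts in the kernel
* (α) `RowAlpha1.RuleDSharp` — the DERIVED row (memo-211 THEOREM α1, sheaf door, cokernel orientation): both `T_W`-blocks `B¹, B²` of every
  supported cell at every `g < j` lie in the `ℚ(i)`-span of the ELEMENTARY SUPPLIES `u vᵀ` of the supplier pairs present (`u`, `v` free on an
  EQUAL leg, on the line `ℤ[i]·(Δa, conj Δβ)` on a NULL leg).
* (γ) `FineDoorRing2.RuleDPFine` (+ the N-side twin, the support shadow of `FineDoorRing2.DMassN`, not named there) — c4-1 THEOREM D-MASS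
  support shadow = the FINE LAW under which every room ∕ shell ∕ K4PRUNE certificate of record was computed: per block and per RANK-1
  functional `λ ⊗ μ` detecting `M₁` or `M₂`, a partner is present whose null legs are NOT annihilated (`DMassCounts`).
* (coarse) `LeggedFloor.RuleD` — already `RowAlpha1.ruleD_of_ruleDSharp`.

**KERNEL HERE: (α) ⇒ (γ) on both sides** (`ruleDPFine_of_ruleDSharp`, `ruleDNFine_of_ruleDSharp`), by the six pen lines of ALPHA1SHARP §1:
(1) the dictionaries differ by a global conjugation — `B¹ = conj M₁`, `B² = conj M₂`, `nullLine = conj lineVec` entrywise (§1);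
(2) a rank-1 functional is a functional: `Λ(λ, μ) := λ̄ ⊗ μ̄` has `⟨Λ, B¹⟩ = conj((λ ⊗ μ)(M₁))`, so `FDetects λ μ M₁ ⇒ ⟨Λ, B¹⟩ ≠ 0` (§1);
(3) `SuppliedP ∕ SuppliedN` with `⟨Λ, B⟩ ≠ 0` hands over ONE supplier pair and ONE elementary supply `u vᵀ` with `⟨Λ, u vᵀ⟩ = (λ̄·u)(μ̄·v) ≠ 0`
    (contrapositive of hsem-3's `not_suppliedP∕N_of_functional`, §2);
(4) on a null leg `u = t • nullLine` and `λ̄·u = t · conj(λ · lineVec)`, so `λ̄·u ≠ 0 ⇒ ¬ Annihilates λ` (§1);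
(5) the supplier pair is identical ∕ a leg on `g` ∕ a leg on `j` ∕ an (r2a) partner according to which of its two block legs are EQUAL, and (4)
    supplies exactly the non-annihilation each `DMassCounts` disjunct asks for (§3).
§4 re-reads `FineDoorRing2`'s kernel consequences BEHIND ROW α1♯ (`noNUnit4`, `copies ≥ 400 ∕ ≥ 520`, the empty open cell `copies ≤ 108`,
fine shell 3's charged-N anatomy): every fine-law kill of record is a DERIVED kill for the sheaf door's row α1, now by `import`, not by pen.
§5 calibration: hsem-3's strictness witness `DLeg` (passes RULE D, fails (α)) also FAILS (γ) — its certificate `LamLeg` IS the rank-1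
functional `Λ((1, −i), (0, 1))` — consistent with ALPHA1SHARP §1 «(α) = (γ) wherever a block is fed through a LEG».

Honest ledger: an implication between two typed letter-model sieves and its corollaries; (γ) ⇏ (α) in general (r2a-only triples in general
position, ALPHA1SHARP §1 — no support-level separating object of record); pen ≠ kernel for memo-211's «sheaf datum ⇒ (α)» (req-200's four
named facts); letters ≠ sheaves ≠ SEED; typed ≠ proved.
-/

set_option linter.dupNamespace false
set_option autoImplicit false

namespace Summit.HodgeConjecture.HodgeConjecture.Cruxes.BlochSeedDiscOne.RowAlpha1Fine

open Summit.HodgeConjecture.HodgeConjecture.Cruxes.BlochSeedDiscOne.DepthBoundA4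
open Summit.HodgeConjecture.HodgeConjecture.Cruxes.BlochSeedDiscOne.LeggedFloor (NullStep Supplies Detects RuleD Disj)
open Summit.HodgeConjecture.HodgeConjecture.Cruxes.BlochSeedDiscOne.RuleDPlate (HallPlusUp)
open Summit.HodgeConjecture.HodgeConjecture.Cruxes.BlochSeedDiscOne.RingTwoMassLaw (Ring2 NoNUnit4)
open Summit.HodgeConjecture.HodgeConjecture.Cruxes.BlochSeedDiscOne.DeepLayerLaws (RingLe)
open Summit.HodgeConjecture.HodgeConjecture.Cruxes.BlochSeedDiscOne.RowAlpha1
open Summit.HodgeConjecture.HodgeConjecture.Cruxes.BlochSeedDiscOne.FineDoorRing2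
  (intG blockM₁ blockM₂ lineVec gPairing Annihilates FDetects DMassValid IsLeg IsR2a DMassCounts RuleDPFine
   noNUnit4_of_fine fineDoor_copies_ge_520 fineDoor_copies_ge_400 fineDoor_empty_le_108 charged_N_fine_ring3
   offaxisN_le_one_fine_ring3 offaxisP_le_two_fine_ring3 offCount)

/-! ## §1 The conjugation dictionary and the rank-1 functional `Λ(λ, μ) = λ̄ ⊗ μ̄` -/

/-- `FineDoorRing2.intG` and `RowAlpha1.zi` are the same integer cast. -/
theorem intG_eq_zi (n : ℤ) : intG n = zi n := rfl

/-- an integer is self-conjugate. -/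
theorem star_intG (n : ℤ) : star (intG n) = zi n := by
  ext <;> simp [intG, zi]

/-- `B¹ = conj M₁` entrywise (hsem-3's blocks are the conjugates of the spec's). -/
theorem B1_apply_eq_star (c : Cell) (g j : Fin 4) (r s : Fin 2) : B1 c g j r s = star (blockM₁ c g j r s) := by
  fin_cases r <;> fin_cases s <;> simp [B1, blockM₁, star_intG]

/-- `B² = conj M₂` entrywise. -/
theorem B2_apply_eq_star (c : Cell) (g j : Fin 4) (r s : Fin 2) : B2 c g j r s = star (blockM₂ c g j r s) := by
  fin_cases r <;> fin_cases s <;> simp [B2, blockM₂, star_intG]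

/-- `nullLine = conj lineVec` entrywise (`(Δa, conj Δβ)` vs `(Δa, Δβ)`). -/
theorem nullLine_apply_eq_star (lo up : Letter) (r : Fin 2) : nullLine lo up r = star (lineVec lo up r) := by
  fin_cases r <;> simp [nullLine, lineVec, star_intG]

/-- entrywise conjugate of a covector. -/
def conjVec (l : Fin 2 → GaussianInt) : Vec := fun r => star (l r)

/-- the RANK-1 functional `Λ(λ, μ) := λ̄ ⊗ μ̄` on the `(g, j)` block space, as a matrix paired by `RowAlpha1.pairing`. -/
def rankOne (l m : Fin 2 → GaussianInt) : Mat := outer (conjVec l) (conjVec m)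

/-- `λ̄ · u = Σ_r conj(λ_r) u_r`. -/
def cdot (l u : Fin 2 → GaussianInt) : GaussianInt := star (l 0) * u 0 + star (l 1) * u 1

/-- a rank-1 functional detects THROUGH conjugation: `⟨λ̄ ⊗ μ̄, conj M⟩ = conj((λ ⊗ μ)(M))`. -/
theorem pairing_rankOne_star (l m : Fin 2 → GaussianInt) (M N : Mat) (hMN : ∀ r s, N r s = star (M r s)) :
    pairing (rankOne l m) N =
      star (l 0 * M 0 0 * m 0 + l 0 * M 0 1 * m 1 + l 1 * M 1 0 * m 0 + l 1 * M 1 1 * m 1) := by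
  simp only [pairing, Fin.sum_univ_two, rankOne, outer, conjVec, hMN, star_add, star_mul']
  ring

/-- hence `FDetects λ μ M ⇒ ⟨Λ(λ, μ), conj M⟩ ≠ 0`. -/
theorem pairing_rankOne_ne_zero_of_fdetects {l m : Fin 2 → GaussianInt} {M N : Mat} (hMN : ∀ r s, N r s = star (M r s))
    (h : FDetects l m M) : pairing (rankOne l m) N ≠ 0 := by
  rw [pairing_rankOne_star l m M N hMN]
  exact fun h0 => h (star_eq_zero.mp h0)

/-- `⟨λ̄ ⊗ μ̄, u vᵀ⟩ = (λ̄ · u)(μ̄ · v)`. -/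
theorem pairing_rankOne_outer (l m u v : Fin 2 → GaussianInt) :
    pairing (rankOne l m) (outer u v) = cdot l u * cdot m v := by
  simp only [pairing_outer, Fin.sum_univ_two, rankOne, outer, conjVec, cdot]
  ring

/-- on a NULL leg the supply line pairs with `λ̄` through `λ · lineVec`: `λ̄ · (t • nullLine) = t · conj(λ · lineVec)`. -/
theorem cdot_smul_nullLine (l : Fin 2 → GaussianInt) (t : GaussianInt) (lo up : Letter) :
    cdot l (t • nullLine lo up) = t * star (gPairing l (lineVec lo up)) := by
  simp only [cdot, Pi.smul_apply, smul_eq_mul, nullLine_apply_eq_star, gPairing, star_add, star_mul']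
  ring

/-- … so a supply vector on a null leg that pairs non-trivially with `λ̄` certifies `¬ Annihilates λ`. -/
theorem not_annihilates_of_cdot_ne_zero {l : Fin 2 → GaussianInt} {t : GaussianInt} {lo up : Letter}
    (h : cdot l (t • nullLine lo up) ≠ 0) : ¬ Annihilates l lo up := by
  intro hann
  apply h
  rw [cdot_smul_nullLine, show gPairing l (lineVec lo up) = 0 from hann, star_zero, mul_zero]

/-! ## §2 A supplied block that a functional detects hands over ONE supplier and ONE elementary supply the functional sees
(contrapositive of `RowAlpha1.not_suppliedP_of_functional` ∕ `not_suppliedN_of_functional`) -/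

/-- P side. -/
theorem exists_elemSupply_of_suppliedP {D : Design} {x : Cell} {g j : Fin 4} {B Λ : Mat}
    (h : SuppliedP D x g j B) (hB : pairing Λ B ≠ 0) :
    ∃ y ∈ D.suppN, Supplies x y g j ∧ ∃ M, ElemSupply x y g j M ∧ pairing Λ M ≠ 0 := by
  by_contra hcon
  push Not at hcon
  exact not_suppliedP_of_functional D x g j B Λ hcon hB h

/-- N side. -/
theorem exists_elemSupply_of_suppliedN {D : Design} {y : Cell} {g j : Fin 4} {B Λ : Mat}
    (h : SuppliedN D y g j B) (hB : pairing Λ B ≠ 0) :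
    ∃ x ∈ D.suppP, Supplies x y g j ∧ ∃ M, ElemSupply x y g j M ∧ pairing Λ M ≠ 0 := by
  by_contra hcon
  push Not at hcon
  exact not_suppliedN_of_functional D y g j B Λ hcon hB h

/-! ## §3 An elementary supply seen by `Λ(λ, μ)` makes its supplier pair COUNTED for `(g, j; λ, μ)` -/

/-- the four `DMassCounts` cases = the four EQUAL ∕ NULL patterns of the supplier pair's two block legs. -/
theorem dmassCounts_of_elemSupply {x y : Cell} {g j : Fin 4} (hgj : g < j) (hS : Supplies x y g j)
    {M : Mat} (hM : ElemSupply x y g j M) {l m : Fin 2 → GaussianInt} (hp : pairing (rankOne l m) M ≠ 0) :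
    DMassCounts x y g j l m := by
  obtain ⟨u, v, hu, hv, rfl⟩ := hM
  rw [pairing_rankOne_outer] at hp
  have hu0 : cdot l u ≠ 0 := left_ne_zero_of_mul hp
  have hv0 : cdot m v ≠ 0 := right_ne_zero_of_mul hp
  obtain ⟨hoff, hg, hj⟩ := hS
  unfold DMassCounts
  by_cases heg : x g = y g
  · by_cases hej : x j = y j
    · -- identical partner
      refine Or.inl (funext fun f => ?_)
      by_cases hfg : f = g
      · rw [hfg]; exact heg
      by_cases hfj : f = j
      · rw [hfj]; exact hej
      exact hoff f hfg hfj
    · -- leg on `j`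
      have hnullj : NullStep (x j) (y j) := hj.resolve_left hej
      obtain ⟨t, rfl⟩ : ∃ t : GaussianInt, v = t • nullLine (x j) (y j) := Or.resolve_left hv hej
      refine Or.inr (Or.inr (Or.inl ⟨⟨hnullj, fun f hfj => ?_⟩, not_annihilates_of_cdot_ne_zero hv0⟩))
      by_cases hfg : f = g
      · rw [hfg]; exact heg
      exact hoff f hfg hfj
  · have hnullg : NullStep (x g) (y g) := hg.resolve_left heg
    obtain ⟨t, rfl⟩ : ∃ t : GaussianInt, u = t • nullLine (x g) (y g) := Or.resolve_left hu heg
    by_cases hej : x j = y j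
    · -- leg on `g`
      refine Or.inr (Or.inl ⟨⟨hnullg, fun f hfg => ?_⟩, not_annihilates_of_cdot_ne_zero hu0⟩)
      by_cases hfj : f = j
      · rw [hfj]; exact hej
      exact hoff f hfg hfj
    · -- (r2a) partner
      have hnullj : NullStep (x j) (y j) := hj.resolve_left hej
      obtain ⟨t', rfl⟩ : ∃ t' : GaussianInt, v = t' • nullLine (x j) (y j) := Or.resolve_left hv hej
      exact Or.inr (Or.inr (Or.inr ⟨⟨ne_of_lt hgj, hnullg, hnullj, fun f hfg hfj => hoff f hfg hfj⟩,
        not_annihilates_of_cdot_ne_zero hu0, not_annihilates_of_cdot_ne_zero hv0⟩))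

/-! ## §4 THE KERNEL DEBT: (α) ⇒ (γ), both sides, and `FineDoorRing2` behind ROW α1♯ -/

/-- **ROW α1♯ IMPLIES THE FINE DOOR, P side**: `RuleDSharp D → RuleDPFine D`. -/
theorem ruleDPFine_of_ruleDSharp (D : Design) (h : RuleDSharp D) : RuleDPFine D := by
  intro x hx g j l m hval
  obtain ⟨hgj, hdet⟩ := hval
  obtain ⟨B, hsup, hB⟩ : ∃ B, SuppliedP D x g j B ∧ pairing (rankOne l m) B ≠ 0 := by
    rcases hdet with h1 | h2
    · exact ⟨B1 x g j, (h.2 x hx g j hgj).1, pairing_rankOne_ne_zero_of_fdetects (B1_apply_eq_star x g j) h1⟩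
    · exact ⟨B2 x g j, (h.2 x hx g j hgj).2, pairing_rankOne_ne_zero_of_fdetects (B2_apply_eq_star x g j) h2⟩
  obtain ⟨y, hy, hS, M, hM, hp⟩ := exists_elemSupply_of_suppliedP hsup hB
  exact ⟨y, hy, dmassCounts_of_elemSupply hgj hS hM hp⟩

/-- **ROW α1♯ IMPLIES THE FINE DOOR, N side** (the support shadow of `FineDoorRing2.DMassN`, stated unfolded since that file names only the
P side): every valid functional of every supported N-cell has a COUNTED server in `suppP`. -/
theorem ruleDNFine_of_ruleDSharp (D : Design) (h : RuleDSharp D) :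
    ∀ y ∈ D.suppN, ∀ g j : Fin 4, ∀ l m : Fin 2 → GaussianInt, DMassValid y g j l m →
      ∃ x ∈ D.suppP, DMassCounts x y g j l m := by
  intro y hy g j l m hval
  obtain ⟨hgj, hdet⟩ := hval
  obtain ⟨B, hsup, hB⟩ : ∃ B, SuppliedN D y g j B ∧ pairing (rankOne l m) B ≠ 0 := by
    rcases hdet with h1 | h2
    · exact ⟨B1 y g j, (h.1 y hy g j hgj).1, pairing_rankOne_ne_zero_of_fdetects (B1_apply_eq_star y g j) h1⟩
    · exact ⟨B2 y g j, (h.1 y hy g j hgj).2, pairing_rankOne_ne_zero_of_fdetects (B2_apply_eq_star y g j) h2⟩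
  obtain ⟨x, hx, hS, M, hM, hp⟩ := exists_elemSupply_of_suppliedN hsup hB
  exact ⟨x, hx, dmassCounts_of_elemSupply hgj hS hM hp⟩

/-- the sandwich at support level: ROW α1♯ gives the coarse door AND the fine door at once. -/
theorem ruleD_and_ruleDPFine_of_ruleDSharp (D : Design) (h : RuleDSharp D) : RuleD D ∧ RuleDPFine D :=
  ⟨ruleD_of_ruleDSharp D h, ruleDPFine_of_ruleDSharp D h⟩

section
variable {D : Design}

/-- `FineDoorRing2.noNUnit4_of_fine` behind ROW α1♯: on the height-14 ring-2 alphabet with `Disj`, no supported N-cell is unit⁴. -/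
theorem noNUnit4_of_ruleDSharp (hD : D.OnAlphabet 14) (hR : Ring2 D) (hdisj : Disj D) (h : RuleDSharp D) : NoNUnit4 D :=
  noNUnit4_of_fine hD hR hdisj (ruleD_of_ruleDSharp D h) (ruleDPFine_of_ruleDSharp D h)

/-- `FineDoorRing2.fineDoor_copies_ge_400` behind ROW α1♯ (ring 2, (A1), `μ ≠ 0`): `400 ≤ copies`. -/
theorem copies_ge_400_of_ruleDSharp (hD : D.OnAlphabet 14) (hR : Ring2 D) (hdisj : Disj D) (h1 : D.A1) (h : RuleDSharp D)
    (hμ : D.mu ≠ 0) : 400 ≤ D.copies :=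
  fineDoor_copies_ge_400 hD hR hdisj (ruleD_of_ruleDSharp D h) h1 (ruleDPFine_of_ruleDSharp D h) hμ

/-- `FineDoorRing2.fineDoor_copies_ge_520` behind ROW α1♯ (with the Hall row `HallPlusUp D 8` of that file's era): `520 ≤ copies`. -/
theorem copies_ge_520_of_ruleDSharp (hD : D.OnAlphabet 14) (hR : Ring2 D) (hdisj : Disj D) (h1 : D.A1) (h : RuleDSharp D)
    (hμ : D.mu ≠ 0) (hU8 : HallPlusUp D 8) : 520 ≤ D.copies :=
  fineDoor_copies_ge_520 hD hR hdisj (ruleD_of_ruleDSharp D h) h1 (ruleDPFine_of_ruleDSharp D h) hμ hU8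

/-- `FineDoorRing2.fineDoor_empty_le_108` behind ROW α1♯: the ring ledger's open cell `copies ≤ 108` is EMPTY behind the derived row too. -/
theorem empty_le_108_of_ruleDSharp (hD : D.OnAlphabet 14) (hR : Ring2 D) (hdisj : Disj D) (h1 : D.A1) (h : RuleDSharp D)
    (hμ : D.mu ≠ 0) (hU8 : HallPlusUp D 8) (hB : D.copies ≤ 108) : False :=
  fineDoor_empty_le_108 hD hR hdisj (ruleD_of_ruleDSharp D h) h1 (ruleDPFine_of_ruleDSharp D h) hμ hU8 hB

/-- `FineDoorRing2.charged_N_fine_ring3` behind ROW α1♯ (FINE SHELL 3): a hub-free supported N-cell of shell 3 has no deep letter and at most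
one mid letter. -/
theorem charged_N_ring3_of_ruleDSharp (hD : D.OnAlphabet 14) (hR : RingLe 3 D) (hdisj : Disj D) (h : RuleDSharp D)
    {y : Cell} (hy : y ∈ D.suppN) (hch : ∀ f : Fin 4, (y f).colevel ≠ 0) :
    (∀ f : Fin 4, (y f).colevel ≠ 3) ∧ (∀ f g : Fin 4, f ≠ g → (y f).colevel = 2 → (y g).colevel = 2 → False) :=
  charged_N_fine_ring3 hD hR hdisj (ruleD_of_ruleDSharp D h) (ruleDPFine_of_ruleDSharp D h) hy hch

/-- `FineDoorRing2.offaxisN_le_one_fine_ring3` behind ROW α1♯: on shell 3 a hub-free supported N-cell has at most ONE off-axis letter. -/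
theorem offaxisN_le_one_ring3_of_ruleDSharp (hD : D.OnAlphabet 14) (hR : RingLe 3 D) (hdisj : Disj D) (h : RuleDSharp D)
    {y : Cell} (hy : y ∈ D.suppN) (hch : ∀ f : Fin 4, ¬((y f).x = 0 ∧ (y f).y = 0)) : offCount y ≤ 1 :=
  offaxisN_le_one_fine_ring3 hD hR hdisj (ruleD_of_ruleDSharp D h) (ruleDPFine_of_ruleDSharp D h) hy hch

/-- `FineDoorRing2.offaxisP_le_two_fine_ring3` behind ROW α1♯: on shell 3 a hub-free supported P-cell has at most TWO off-axis letters. -/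
theorem offaxisP_le_two_ring3_of_ruleDSharp (hD : D.OnAlphabet 14) (hR : RingLe 3 D) (hdisj : Disj D) (h : RuleDSharp D)
    {x : Cell} (hx : x ∈ D.suppP) (hch : ∀ f : Fin 4, ¬((x f).x = 0 ∧ (x f).y = 0)) : offCount x ≤ 2 :=
  offaxisP_le_two_fine_ring3 hD hR hdisj (ruleD_of_ruleDSharp D h) (ruleDPFine_of_ruleDSharp D h) hx hch

end

/-! ## §5 Calibration: hsem-3's strictness witness `DLeg` fails the fine door as well — `LamLeg` IS a rank-1 functional
(`RowAlpha1` §4: `xLeg → yLeg` passes RULE D and fails (α) at the block `(0, 1)` of `yLeg` by `LamLeg = [[0, 1], [0, i]]`; that certificate is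
`Λ((1, −i), (0, 1))`, so the SAME block fails (γ)'s N side: the only supplier `xLeg` is a leg on factor `0` whose line `(4, −4i)` is annihilated by
`λ = (1, −i)`, and no leg ∕ (r2a) on factor `1` (equal hubs).  On this legged support (α) and (γ) fail together, as ALPHA1SHARP §1 predicts.) -/

/-- the covector `λ = (1, −i)` on factor `0`. -/
def lamLeg0 : Fin 2 → GaussianInt := ![1, ⟨0, -1⟩]

/-- the covector `μ = (0, 1)` on factor `1`. -/
def muLeg1 : Fin 2 → GaussianInt := ![0, 1]

/-- hsem-3's certificate is the rank-1 functional `λ̄ ⊗ μ̄`. -/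
theorem rankOne_lamLeg : rankOne lamLeg0 muLeg1 = LamLeg := by
  funext r s
  fin_cases r <;> fin_cases s <;> decide

/-- `(0, 1; λ, μ)` is a VALID functional for `yLeg` (it detects `M₁(yLeg; 0, 1)`: the value is `conj(9 − 4i) ≠ 0`). -/
theorem dmassValid_yLeg : DMassValid yLeg 0 1 lamLeg0 muLeg1 := by
  refine ⟨by decide, Or.inl ?_⟩
  unfold FDetects blockM₁ yLeg lamLeg0 muLeg1 intG
  decide

/-- … and its only candidate server `xLeg` is NOT counted: `λ` annihilates the null line `(4, −4i)` of factor `0`, factor `1` is an equal leg. -/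
theorem not_dmassCounts_leg : ¬ DMassCounts xLeg yLeg 0 1 lamLeg0 muLeg1 := by
  unfold DMassCounts IsLeg IsR2a Annihilates gPairing lineVec NullStep xLeg yLeg lamLeg0 muLeg1 intG
  decide

/-- **`DLeg` fails the fine door's N side** at `(yLeg; 0, 1; (1, −i), (0, 1))`. -/
theorem not_fineN_DLeg : ¬ (∀ y ∈ DLeg.suppN, ∀ g j : Fin 4, ∀ l m : Fin 2 → GaussianInt, DMassValid y g j l m →
    ∃ x ∈ DLeg.suppP, DMassCounts x y g j l m) := by
  intro h
  obtain ⟨x, hx, hc⟩ := h yLeg (by rw [suppN_DLeg]; simp) 0 1 lamLeg0 muLeg1 dmassValid_yLeg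
  rw [suppP_DLeg, List.mem_singleton] at hx
  subst hx
  exact not_dmassCounts_leg hc

end Summit.HodgeConjecture.HodgeConjecture.Cruxes.BlochSeedDiscOne.RowAlpha1Fine
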